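/-
Copyright: statement-level skeleton of a published paper (lit-balaban cell, Phase-2 proof seat p27, gen 31; v1.1 gen 33). No proof claims
beyond what the kernel checks below.
-/
import Mathlib
import Literature.MathematicalPhysics.QuantumFieldTheory.BalabanImbrieJaffe1984to88.BIJ85Eq7114Tau1Identification

/-!
# `BalabanImbrieJaffe1984to88.BIJ85Tau1ClosedCube` — T. Bałaban, J. Imbrie, A. Jaffe, *Renormalization of the Higgs model:
minimizers, propagators and the stability of mean field theory*, Commun. Math. Phys. **97** (1985) 299–329 [BalabanImbrieJaffe1985]:
Sect. 7.1 pp. 322–323, (7.1.14)/(7.1.17) — **`τ₁(p′)` IS THE REGULARIZED (7.1.14) AT EVERY MOMENTUM, AXIS FIBRES AND `p′ = 0`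
INCLUDED**: the unconstrained fibre minimum `m°_{p′}(f) = inf_A ‖∂A − Q^{e*}_kf‖²` of the (4.2.1) exponent, written with seat p10's
DIVISION-FREE closed-cube weights (`BIJ85Eq7113DerivationPart5.energyC`: block-average symbol `v_μ = ηΣ_{j<n}e^{ijηq_μ}` with its
removable singularity filled, edge weight `wC`), is attained and equals `Re⟨f, τ₁^C(p′)f⟩` with p10's closed-cube (7.1.14)
`BIJ85SigmaClosedCube.tau1C` — at EVERY `p′ ∈ ℝ^d`, by the shift-wise Hodge split `Q^{e*}_kf = ∂B₀ + (P ⊗ P)Q^{e*}_kf` with the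
bracket `P = [δ − ∂∂̄/Δ]` (which is the identity where `∂(p′+l) = 0`); hence `fibreMinU (2M+1) N q φ = 2·Re⟨φ, τ₁^C(q)φ⟩` at EVERY dual
momentum `q` and, for the τ₁ OF RECORD (p33's `τ₁ = Q^e_k(I − P_∂)Q^{e*}_k`, (7.1.17)), `⟨ψ, τ₁(p′)ψ⟩ = Re⟨ψ^asym, τ₁^C(p′)ψ^asym⟩` at EVERY
dual momentum `p′` of `T₁^{(k)}` — the gen-6 theorem `BIJ85Eq7114Tau1Identification.symb_tau1Matrix_form_eq_tau1Sym` (generic `p′`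
only, printed symbols) extended to the coordinate axes in the regularized reading (file 1 of 3 of the axis-fibre completion; files 2–3
`BIJ85Eq7113ClosedCubeMinimiser`, `BIJ85Eq7113AxisFibres` do the constrained problem `σ_k = τ₁ + τ₂`)

statement-level skeleton of published theorems with citation tags; proofs where landed; nothing here is a claim about
the Yang–Mills mass gap

PDF held: `paper:balaban1985-cmp97-bij-higgs-minimizers` (journal page = PDF page + 298); pp. 322–323 [PDF 24–25] re-read as images
(`run/shared/lean/pub/pub-balaban/t4/b2b-balaban-t4-lit2/renders/bij1985/1985-cmp97-bij-higgs-minimizers-p024-x2.png`, `…-p025-x2.png`).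

THE PRINTED TEXT (verbatim, pp. 322–323; v1.1 — the quotation block of v1.0 (p336827) corrected at the locus of referee ref-1's gen-70
fidelity note against the renders `…-p024-x2.png`/`…-p025-x2.png`: an unprinted sentence removed from the marks before (7.1.17) and the
printed lead-in to (7.1.17) quoted instead; declarations untouched).  *"We express σ_k as a sum of two terms σ_k = τ₁ + τ₂. (7.1.13) Here
τ₁ vanishes on curls. Thus if f = ∂B, then τ₁f = 0. Explicitly τ_{1,μνλκ}(p′) = ½Σ_l(|u|²/(v̄_μv̄_νv_λv_κ)[δ_{μλ} − ∂_μ∂̄_λ/Δ][δ_{νκ} − ∂_ν∂̄_κ/Δ])(p′+l),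
(7.1.14) … In the formula for τ₁(p′), each term on the right side is evaluated at momentum p′ + l. … In both τ₁ and τ₂ the expressions
inside brackets [ ] are projection operators. Thus σ_k has the general form of a sum of projection operators, or tensor products of
projection operators, sandwiched between averaging operators. The fact that τ₁ vanishes on curls can be established as follows: The
general form of τ₁ in configuration space is evident from (7.1.11), (7.1.14) namely τ₁ = Q^e_k(I − P_∂)Q^{e*}_k, (7.1.17) where P_∂ denotes
the orthogonal projection onto curls."*  READING (ours, not printed).  At a momentum with a vanishing component `p′_μ = 0` the printed
quotient `v_μ = ∂^{(1)}_μ(p′)/∂_μ(p′+l)` of (7.1.7) is `0/0` at the shift `l_μ = 0` (GAPS G-C1-03); the block average it denotes has the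
value 1 there ([6I] = Bałaban CMP 95 p. 23), which is what p10's `vC` takes.

CITATION HEADER (lean-in-tree rule).  Part of the lit-balaban TYPED SKELETON (HOME `run/shared/lean/pub/lit-balaban/`), Phase-2 seat p27
(gen 31), unit `lit-balaban-p27`; rows **C1.Eq7.1.13-7.1.19** and **C1.Eq7.1.2-7.1.12** of `HOME/SKELETON.md` (fold owner r15, referee ref-5);
r15's `C1-CLOSURE.md` §5 item 1 *"(7.1.x) on the axis fibres … a regularized statement of (7.1.14)–(7.1.16) at p′_μ = 0 matching the
closed-cube forms"*.  INPUTS (all landed, consumed by name): p10's `BIJ85SigmaClosedCube` (`zC`, `vC`, `qeW`, `t1C`, `tau1C`, `gW`,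
`tau1C_form_eq`), `BIJ85SigmaClosedCubeZero` (`tensorInner_t1C_eq`: the l-term form is `‖(P⊗P)(w·f)‖²` at EVERY momentum; `tensorInner_tau1C`),
`BIJ85Eq7113Derivation` (`curlF`, `pNormSq`, `coD`), `BIJ85Eq7113DerivationPart5` (`wC`, `qeStarC`, `energyC`, `zC_pow_mul_conj_vC`),
`BIJ85Eq7113DerivationPart6` (`resE`, `resR`, `fibreEnergy_eq`); gen-2 `BIJ85CurlComplement719.projK` (+ `BIJ85Tau2Kernel715.projK_mulVec_self`);
this seat's gen-6 `BIJ85Eq7117FibreMinFree.fibreMinU`, `BIJ85Eq7117Tau1Symbol.symb_tau1Matrix_form_eq_half_fibreMinU`,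
`BIJ85Eq7113SymbolIdentification.energyC_comp_res`.
WHAT IS KERNEL-CHECKED (zero `sorry`, standard axioms; THEOREMS ONLY — no `def`, no new named fact, D-0026):
§1 the conjugate edge weight is the Q^e-weight up to ONE unimodular phase per shift: `conj (wC)_{μν}(q) = c̄(q)·(u/(v_μv_ν))(q)`,
`c̄(q) = Π_ρ conj(z_ρ(q))^{n−1}` (`conj_wC_eq`, `norm_phase`; so `Q^{e*}_kf = c̄·(w·f)` on two-forms, `qeStarC_eq_phase_mul_gW`);
§2 the pointwise Hodge split against an ARBITRARY vector `∂` (zero allowed): `G = ∂ ∧ (Δ⁻¹∂^*G) + (P⊗P)G` for antisymmetric `G`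
(`hodge_point`), `(P⊗P)(∂ ∧ a) = 0` (`kron_projK_mulVec_curl`), `‖(P⊗P)X‖ ≤ ‖X‖` (private), hence at one shift
`Σ|∂∧a − G|² ≥ ‖(P⊗P)G‖²` with equality at `a = Δ⁻¹∂^*G` (`curl_energy_ge`, `curl_energy_hodge`);
§3 **`tau1C_form_le_energyC`** (`Re⟨f, τ₁^C(p′)f⟩ ≤ ‖∂A − Q^{e*}_kf‖²_C` for EVERY `A`, EVERY `p′`, two-forms `f`, `0 < n`, any cut-off `M`),
**`energyC_hodge_eq`** (equality at `A = B₀ = Δ⁻¹∂^*Q^{e*}_kf`, shift by shift), **`isLeast_energyC_free`**;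
§4 **`fibreMinU_eq_two_mul_tau1C_form`**: `fibreMinU (2M+1) N q φ = 2·Re⟨φ, τ₁^C(q)φ⟩` for two-forms `φ` at EVERY `q : Tor N` (no genericity,
no `0 < d`); §5 **`symb_tau1Matrix_form_eq_tau1C`**: for the τ₁ of record (`k ≤ m + K`, `2 ≤ d`, any curl factor `c ≠ 0`, `L^k = 2M + 1`),
at EVERY dual momentum `p′` and every fibre vector `ψ`, `⟨ψ, τ₁(p′)ψ⟩ = Re⟨ψ^asym, tau1C (2M+1) M (p′) ψ^asym⟩`; consistency: at generic `p′`
p10's `tau1C_form_eq` turns the right side into gen 6's `tau1Sym` statement `symb_tau1Matrix_form_eq_tau1Sym` (the re-derivation is an exact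
restatement of that landed theorem — `dedup.landed` at the dry run — and is therefore not repeated here).
HONEST SCOPE: the closed-cube symbols are p10's regularization (the printed (7.1.14) evaluated with the continuous extension of `v_μ` and
`P(0) = δ`), not a new reading of print; odd block sizes `n = 2M + 1` only at the `Tor` level (the σ_k/τ₁ of record live on `Setup` tori,
`L` odd by `Params.hL`; the configuration-space Theorem 7.1.1 for every `L` is p10's `BIJ85Thm711AllL`, GAPS G-C1-p27-02 RESOLVED).
-/

namespace Literature.MathematicalPhysics.QuantumFieldTheory.BalabanImbrieJaffe1984to88.BIJ85Tau1ClosedCube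

open scoped BigOperators Matrix ComplexConjugate Kronecker
open Literature.MathematicalPhysics.QuantumFieldTheory.Balaban1983to89
open B5Prop11Plancherel (Tor fine sOf abs_sOf_le)
open B5Eq117TorusCarriers (Mk)
open BIJ85MomentumSymbols71 (tensorInner dSym lapSym lShifts shiftMom tau1Sym zero_mem_lShifts)
open BIJ85CurlComplement719 (IsTwoForm projK projK_apply projK_conjTranspose projK_mul_projK)
open BIJ85Prop712Fibre (projK_conj)
open BIJ85Tau2Kernel715 (projK_mulVec_self)
open BIJ85SigmaClosedCube (zC vC uC qeW t1C tau1C gW tau1C_form_eq twoForm_diag)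
open BIJ85SigmaClosedCubeZero (tensorInner_t1C_eq tensorInner_tau1C half_term_le_tau1C)
open BIJ85Eq7113Derivation (curlF pNormSq coD)
open BIJ85Eq7113DerivationPart5 (wC qeStarC energyC zC_pow_mul_conj_vC)
open BIJ85Eq7113DerivationPart6 (resE resR fibreEnergy_eq)
open BIJ85Eq7112FibreEnergy (fibreEnergy)
open BIJ85Eq712Plancherel (symb)
open BIJ85Sigma712Torus (Orient torN)
open BIJ85Eq7112SymbolFibreMin (asymO)
open BIJ85Eq7113SymbolIdentification (energyC_comp_res asymO_swap eta_eq_inv_of_pow_eq)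
open BIJ85Eq7117FibreMinFree (fibreMinU fibreMinU_le le_fibreMinU_iff)
open BIJ85Eq7117Tau1Symbol (tau1Matrix symb_tau1Matrix_form_eq_half_fibreMinU)
open BIJ85Eq7114Tau1Identification (fibreMinU_congr_n)
open BIJ85Sigma421Torus

noncomputable section

variable {d : ℕ}

/-! ## §1 The conjugate edge weight is the Q^e-weight up to one unimodular phase per shift -/

section Phase

variable {n : ℕ}

/-- kernel: `|z_μ(q)| = 1`. [folklore] -/
private theorem norm_zC (n : ℕ) (q : Fin d → ℝ) (μ : Fin d) : ‖zC n q μ‖ = 1 := by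
  rw [zC, Complex.norm_exp_I_mul_ofReal]

/-- kernel: `conj z_μ · z_μ = 1`. [folklore] -/
private theorem conj_zC_mul_zC (n : ℕ) (q : Fin d → ℝ) (μ : Fin d) : conj (zC n q μ) * zC n q μ = 1 := by
  rw [mul_comm, Complex.mul_conj, Complex.normSq_eq_norm_sq, norm_zC]
  simp

/-- kernel: `v̄_μ = z̄_μ^{n−1}·v_μ` for the block-average symbol `v = ηΣ_{j<n}z^j`, `|z| = 1` (p10's `z^{n−1}v̄ = v`).
[cite: BalabanImbrieJaffe1985, (7.1.7) p.322] -/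
theorem conj_vC_eq (hn : 0 < n) (q : Fin d → ℝ) (μ : Fin d) :
    conj (vC n q μ) = conj (zC n q μ) ^ (n - 1) * vC n q μ := by
  have h := zC_pow_mul_conj_vC hn q μ
  calc conj (vC n q μ) = (conj (zC n q μ) * zC n q μ) ^ (n - 1) * conj (vC n q μ) := by
        rw [conj_zC_mul_zC, one_pow, one_mul]
    _ = conj (zC n q μ) ^ (n - 1) * (zC n q μ ^ (n - 1) * conj (vC n q μ)) := by rw [mul_pow]; ring
    _ = conj (zC n q μ) ^ (n - 1) * vC n q μ := by rw [h]

/-- **`conj (w_{μν})(q) = c̄(q)·(u/(v_μv_ν))(q)`** off the diagonal, with the SHIFT-WISE phase `c̄(q) = Π_ρ conj(z_ρ(q))^{n−1}`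
independent of `(μ, ν)`: the conjugate of p10's division-free edge weight `wC` ((7.1.11) with the configuration-space phase of the
edge plaquette) is the Q^e-weight `qeW` of (7.1.14) up to one unimodular number per shift — at EVERY momentum.
[cite: BalabanImbrieJaffe1985, (7.1.11) p.322] -/
theorem conj_wC_eq (hn : 0 < n) (p : Fin d → ℝ) (m : Fin d → ℤ) {μ ν : Fin d} (hμν : μ ≠ ν) :
    conj (wC n p m μ ν) = (∏ ρ, conj (zC n (shiftMom p m) ρ) ^ (n - 1)) * qeW n (shiftMom p m) μ ν := by
  set q := shiftMom p m with hq
  have h1 : ∏ ρ ∈ (Finset.univ.erase μ).erase ν, conj (vC n q ρ) =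
      (∏ ρ ∈ (Finset.univ.erase μ).erase ν, conj (zC n q ρ) ^ (n - 1)) *
        ∏ ρ ∈ (Finset.univ.erase μ).erase ν, vC n q ρ := by
    rw [← Finset.prod_mul_distrib]
    exact Finset.prod_congr rfl fun ρ _ => conj_vC_eq hn q ρ
  have hν : ν ∈ Finset.univ.erase μ := Finset.mem_erase.mpr ⟨hμν.symm, Finset.mem_univ ν⟩
  unfold wC qeW
  rw [map_mul, map_mul, map_pow, map_pow, map_prod, h1,
    ← Finset.mul_prod_erase Finset.univ (fun ρ => conj (zC n q ρ) ^ (n - 1)) (Finset.mem_univ μ),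
    ← Finset.mul_prod_erase (Finset.univ.erase μ) (fun ρ => conj (zC n q ρ) ^ (n - 1)) hν]
  ring

/-- The shift-wise phase is unimodular: `|Π_ρ conj(z_ρ(q))^{n−1}| = 1`. [cite: BalabanImbrieJaffe1985, (7.1.11) p.322] -/
theorem norm_phase (n : ℕ) (q : Fin d → ℝ) : ‖∏ ρ, conj (zC n q ρ) ^ (n - 1)‖ = 1 := by
  rw [norm_prod]
  refine Finset.prod_eq_one fun ρ _ => ?_
  rw [norm_pow, Complex.norm_conj, norm_zC, one_pow]

/-- kernel: the Q^e-weight `Π_{ρ∉{μ,ν}}v_ρ` is symmetric in `(μ, ν)`. [cite: BalabanImbrieJaffe1985, (7.1.11) p.322] -/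
theorem qeW_symm (n : ℕ) (q : Fin d → ℝ) (μ ν : Fin d) : qeW n q ν μ = qeW n q μ ν := by
  unfold qeW
  rw [Finset.erase_right_comm]

/-- kernel: the weighted two-form `g = (u/(vv))·f` of a two-form is a two-form. [cite: BalabanImbrieJaffe1985, (7.1.14) p.322] -/
theorem gW_twoForm (n : ℕ) (q : Fin d → ℝ) {f : Fin d → Fin d → ℂ} (hf : IsTwoForm f) : IsTwoForm (gW n q f) := by
  intro μ ν
  show qeW n q ν μ * f ν μ = -(qeW n q μ ν * f μ ν)
  rw [qeW_symm, hf μ ν, mul_neg]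

/-- **`Q^{e*}_kf = c̄·(w·f)` shift by shift on two-forms**: `qeStarC f (l) = c̄(p′+l)·gW(p′+l) f` (the diagonal entries vanish on
both sides). [cite: BalabanImbrieJaffe1985, (7.1.11) p.322] -/
theorem qeStarC_eq_phase_mul_gW (hn : 0 < n) (p : Fin d → ℝ) (m : Fin d → ℤ) {f : Fin d → Fin d → ℂ} (hf : IsTwoForm f)
    (μ ν : Fin d) :
    qeStarC n p f m μ ν = (∏ ρ, conj (zC n (shiftMom p m) ρ) ^ (n - 1)) * gW n (shiftMom p m) f μ ν := by
  unfold qeStarC gW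
  by_cases hμν : μ = ν
  · subst hμν
    rw [twoForm_diag hf μ, mul_zero, mul_zero, mul_zero]
  · rw [conj_wC_eq hn p m hμν, mul_assoc]

end Phase

/-! ## §2 The pointwise Hodge split against an arbitrary vector `∂` (p10's private Part-2 algebra, re-derived without genericity) -/

section Hodge

/-- kernel: a row of `P = [δ − ∂∂̄/Δ]` against a vector: `Σ_λ P_{μλ}w_λ = w_μ − ∂_μ(Σ_λ∂̄_λw_λ)/Δ`. [folklore] -/
private theorem projK_row_sum (e w : Fin d → ℂ) (μ : Fin d) :
    ∑ l, projK e μ l * w l = w μ - e μ * (∑ l, conj (e l) * w l) / (((∑ ρ, ‖e ρ‖ ^ 2 : ℝ)) : ℂ) := by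
  simp only [projK_apply, sub_mul, Finset.sum_sub_distrib, ite_mul, one_mul, zero_mul, Finset.sum_ite_eq,
    Finset.mem_univ, if_true]
  congr 1
  rw [Finset.mul_sum, Finset.sum_div]
  exact Finset.sum_congr rfl fun l _ => by ring

/-- **The pointwise Hodge split**: for EVERY vector `∂ = e` (zero included) and every antisymmetric `G`,
`G_{μν} = (e_μb_ν − e_νb_μ) + Σ_{λκ}P_{μλ}P_{νκ}G_{λκ}` with `b = Δ⁻¹∂^*G`, `b_ν = (Σ_λ ē_λG_{λν})/Δ` — at `e = 0` the first summand
vanishes and `P = δ`. (p10's `BIJ85Eq7113DerivationPart2.hodge_point`, private there.) [cite: BalabanImbrieJaffe1985, (7.1.17) p.323] -/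
theorem hodge_point (e : Fin d → ℂ) {G : Fin d → Fin d → ℂ} (hG : IsTwoForm G) (μ ν : Fin d) :
    G μ ν = (e μ * ((∑ l, conj (e l) * G l ν) / (((∑ ρ, ‖e ρ‖ ^ 2 : ℝ)) : ℂ)) -
        e ν * ((∑ l, conj (e l) * G l μ) / (((∑ ρ, ‖e ρ‖ ^ 2 : ℝ)) : ℂ))) +
      ∑ l, ∑ κ, projK e μ l * projK e ν κ * G l κ := by
  have hS : ∑ l, ∑ κ, conj (e l) * conj (e κ) * G l κ = 0 := by
    have h : ∑ l, ∑ κ, conj (e l) * conj (e κ) * G l κ = -(∑ l, ∑ κ, conj (e l) * conj (e κ) * G l κ) := by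
      conv_lhs => rw [Finset.sum_comm]
      rw [← Finset.sum_neg_distrib]
      refine Finset.sum_congr rfl fun l _ => ?_
      rw [← Finset.sum_neg_distrib]
      refine Finset.sum_congr rfl fun κ _ => ?_
      rw [hG l κ]
      ring
    linear_combination (1 / 2 : ℂ) * h
  have hrow : ∑ κ, conj (e κ) * G μ κ = -∑ κ, conj (e κ) * G κ μ := by
    rw [← Finset.sum_neg_distrib]
    exact Finset.sum_congr rfl fun κ _ => by rw [hG μ κ]; ring
  have h1 : ∑ l, ∑ κ, projK e μ l * projK e ν κ * G l κ = ∑ l, projK e μ l * ∑ κ, projK e ν κ * G l κ := by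
    refine Finset.sum_congr rfl fun l _ => ?_
    rw [Finset.mul_sum]
    exact Finset.sum_congr rfl fun κ _ => by ring
  have h2 : ∀ l, ∑ κ, projK e ν κ * G l κ =
      G l ν - e ν * (∑ κ, conj (e κ) * G l κ) / (((∑ ρ, ‖e ρ‖ ^ 2 : ℝ)) : ℂ) := fun l => projK_row_sum e (G l) ν
  have h3 : ∑ l, conj (e l) * (G l ν - e ν * (∑ κ, conj (e κ) * G l κ) / (((∑ ρ, ‖e ρ‖ ^ 2 : ℝ)) : ℂ)) =
      ∑ l, conj (e l) * G l ν := by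
    have h4 : ∑ l, conj (e l) * (e ν * (∑ κ, conj (e κ) * G l κ) / (((∑ ρ, ‖e ρ‖ ^ 2 : ℝ)) : ℂ)) =
        e ν / (((∑ ρ, ‖e ρ‖ ^ 2 : ℝ)) : ℂ) * ∑ l, ∑ κ, conj (e l) * conj (e κ) * G l κ := by
      rw [Finset.mul_sum]
      refine Finset.sum_congr rfl fun l _ => ?_
      rw [show (∑ κ, conj (e l) * conj (e κ) * G l κ) = conj (e l) * ∑ κ, conj (e κ) * G l κ from by
        rw [Finset.mul_sum]; exact Finset.sum_congr rfl fun κ _ => by ring]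
      ring
    simp only [mul_sub, Finset.sum_sub_distrib, h4, hS, mul_zero, sub_zero]
  rw [h1]
  simp_rw [h2]
  rw [projK_row_sum, h3, hrow]
  ring

/-- **`(P ⊗ P)(∂ ∧ a) = 0`**: the bracket kills curls in each slot (`P∂ = 0`; at `∂ = 0` the curl itself vanishes).
[cite: BalabanImbrieJaffe1985, (7.1.18) p.323] -/
theorem kron_projK_mulVec_curl (e a : Fin d → ℂ) :
    (projK e ⊗ₖ projK e) *ᵥ (fun i : Fin d × Fin d => e i.1 * a i.2 - e i.2 * a i.1) = 0 := by
  have hPe : ∀ μ, ∑ l, projK e μ l * e l = 0 := by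
    by_cases he : (∑ ρ, ‖e ρ‖ ^ 2) = 0
    · have he0 : ∀ ρ, e ρ = 0 := fun ρ => by
        have h := (Finset.sum_eq_zero_iff_of_nonneg fun i _ => sq_nonneg ‖e i‖).mp he ρ (Finset.mem_univ ρ)
        exact norm_eq_zero.mp (pow_eq_zero_iff two_ne_zero |>.mp h)
      intro μ
      exact Finset.sum_eq_zero fun l _ => by rw [he0 l, mul_zero]
    · intro μ
      have h := congr_fun (projK_mulVec_self he) μ
      simpa [Matrix.mulVec, dotProduct] using h
  funext i
  obtain ⟨μ, ν⟩ := i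
  rw [Pi.zero_apply, Matrix.mulVec, dotProduct, Fintype.sum_prod_type]
  simp only [Matrix.kroneckerMap_apply]
  calc ∑ l, ∑ κ, projK e μ l * projK e ν κ * (e l * a κ - e κ * a l)
      = ∑ l, ∑ κ, (projK e μ l * e l * (projK e ν κ * a κ) - projK e ν κ * e κ * (projK e μ l * a l)) :=
        Finset.sum_congr rfl fun l _ => Finset.sum_congr rfl fun κ _ => by ring
    _ = (∑ l, ∑ κ, projK e μ l * e l * (projK e ν κ * a κ)) - ∑ l, ∑ κ, projK e ν κ * e κ * (projK e μ l * a l) := by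
        rw [← Finset.sum_sub_distrib]
        exact Finset.sum_congr rfl fun l _ => Finset.sum_sub_distrib _ _
    _ = (∑ l, projK e μ l * e l) * (∑ κ, projK e ν κ * a κ) - (∑ κ, projK e ν κ * e κ) * ∑ l, projK e μ l * a l := by
        rw [Finset.sum_mul_sum, Finset.sum_mul_sum, Finset.sum_comm (f := fun κ l => projK e ν κ * e κ * (projK e μ l * a l))]
    _ = 0 := by rw [hPe μ, hPe ν, zero_mul, zero_mul, sub_zero]

/-- kernel: `Σ_i|x_i|²` as the self-pairing `x̄·x`. [folklore] -/
private theorem star_dotProduct_self_eq {ι : Type*} [Fintype ι] (x : ι → ℂ) :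
    star x ⬝ᵥ x = ((∑ i, ‖x i‖ ^ 2 : ℝ) : ℂ) := by
  simp only [dotProduct, Pi.star_apply, Complex.star_def, Complex.conj_mul']
  push_cast
  rfl

/-- kernel: for a self-adjoint idempotent matrix `A`, `x̄·(Ax) = |Ax|²`. [folklore] -/
private theorem star_dot_mulVec_of_proj {ι : Type*} [Fintype ι] [DecidableEq ι] (A : Matrix ι ι ℂ) (hA : Aᴴ = A)
    (hA2 : A * A = A) (x : ι → ℂ) :
    star x ⬝ᵥ (A *ᵥ x) = ((∑ i, ‖(A *ᵥ x) i‖ ^ 2 : ℝ) : ℂ) := by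
  have h : star x ⬝ᵥ (A *ᵥ x) = star (A *ᵥ x) ⬝ᵥ (A *ᵥ x) := by
    rw [Matrix.star_mulVec, hA, ← Matrix.dotProduct_mulVec, Matrix.mulVec_mulVec, hA2]
  rw [h, star_dotProduct_self_eq]

/-- **An orthogonal projection is a contraction**: `Σ_i|(Ax)_i|² ≤ Σ_i|x_i|²` for `Aᴴ = A = A²` (`|x|² = |Ax|² + |(1−A)x|²`).
[folklore] -/
private theorem sum_norm_sq_mulVec_le {ι : Type*} [Fintype ι] [DecidableEq ι] (A : Matrix ι ι ℂ) (hA : Aᴴ = A)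
    (hA2 : A * A = A) (x : ι → ℂ) : ∑ i, ‖(A *ᵥ x) i‖ ^ 2 ≤ ∑ i, ‖x i‖ ^ 2 := by
  have hB : (1 - A)ᴴ = 1 - A := by rw [Matrix.conjTranspose_sub, Matrix.conjTranspose_one, hA]
  have hB2 : (1 - A) * (1 - A) = 1 - A := by
    rw [sub_mul, Matrix.one_mul, mul_sub, Matrix.mul_one, hA2, sub_self, sub_zero]
  have hsplit : star x ⬝ᵥ x = star x ⬝ᵥ (A *ᵥ x) + star x ⬝ᵥ ((1 - A) *ᵥ x) := by
    rw [← dotProduct_add, ← Matrix.add_mulVec, add_sub_cancel, Matrix.one_mulVec]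
  rw [star_dotProduct_self_eq, star_dot_mulVec_of_proj A hA hA2, star_dot_mulVec_of_proj (1 - A) hB hB2] at hsplit
  have h := congrArg Complex.re hsplit
  simp only [Complex.ofReal_re, ← Complex.ofReal_add] at h
  have h0 : 0 ≤ ∑ i, ‖((1 - A) *ᵥ x) i‖ ^ 2 := Finset.sum_nonneg fun i _ => sq_nonneg _
  linarith

/-- kernel: `P ⊗ P` is a self-adjoint idempotent for every `∂` (zero included). [folklore] -/
private theorem kronecker_projK (e : Fin d → ℂ) :
    (projK e ⊗ₖ projK e)ᴴ = projK e ⊗ₖ projK e ∧ (projK e ⊗ₖ projK e) * (projK e ⊗ₖ projK e) = projK e ⊗ₖ projK e := by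
  constructor
  · rw [Matrix.conjTranspose_kronecker, projK_conjTranspose]
  · rw [← Matrix.mul_kronecker_mul, projK_mul_projK]

/-- **`Σ_{μν}|∂_μa_ν − ∂_νa_μ − G_{μν}|² ≥ ‖(P ⊗ P)G‖²`** for every `a`, every vector `∂` and every antisymmetric `G`: the curls are
killed by `P ⊗ P`, which is a contraction. [cite: BalabanImbrieJaffe1985, (7.1.17) p.323] -/
theorem curl_energy_ge (e a : Fin d → ℂ) (G : Fin d → Fin d → ℂ) :
    ∑ i : Fin d × Fin d, ‖((projK e ⊗ₖ projK e) *ᵥ fun i : Fin d × Fin d => G i.1 i.2) i‖ ^ 2 ≤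
      ∑ μ, ∑ ν, ‖e μ * a ν - e ν * a μ - G μ ν‖ ^ 2 := by
  set K := projK e ⊗ₖ projK e with hK
  set Y : Fin d × Fin d → ℂ := fun i => e i.1 * a i.2 - e i.2 * a i.1 - G i.1 i.2 with hY
  have hYs : ∑ μ, ∑ ν, ‖e μ * a ν - e ν * a μ - G μ ν‖ ^ 2 = ∑ i, ‖Y i‖ ^ 2 := by
    rw [Fintype.sum_prod_type]
  have hKY : K *ᵥ Y = -(K *ᵥ fun i : Fin d × Fin d => G i.1 i.2) := by
    have hY' : Y = (fun i : Fin d × Fin d => e i.1 * a i.2 - e i.2 * a i.1) - fun i => G i.1 i.2 := by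
      funext i; simp [hY]
    rw [hY', Matrix.mulVec_sub, hK, kron_projK_mulVec_curl, zero_sub]
  rw [hYs]
  calc ∑ i, ‖(K *ᵥ fun i : Fin d × Fin d => G i.1 i.2) i‖ ^ 2 = ∑ i, ‖(K *ᵥ Y) i‖ ^ 2 := by
        rw [hKY]; simp only [Pi.neg_apply, norm_neg]
    _ ≤ ∑ i, ‖Y i‖ ^ 2 := sum_norm_sq_mulVec_le K (kronecker_projK e).1 (kronecker_projK e).2 Y

/-- **Equality at the Hodge coefficient**: with `b = Δ⁻¹∂^*G`, `Σ_{μν}|∂_μb_ν − ∂_νb_μ − G_{μν}|² = ‖(P ⊗ P)G‖²` (by `hodge_point`,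
`∂ ∧ b − G = −(P ⊗ P)G`). [cite: BalabanImbrieJaffe1985, (7.1.17) p.323] -/
theorem curl_energy_hodge (e : Fin d → ℂ) {G : Fin d → Fin d → ℂ} (hG : IsTwoForm G) :
    ∑ μ, ∑ ν, ‖e μ * ((∑ l, conj (e l) * G l ν) / (((∑ ρ, ‖e ρ‖ ^ 2 : ℝ)) : ℂ)) -
        e ν * ((∑ l, conj (e l) * G l μ) / (((∑ ρ, ‖e ρ‖ ^ 2 : ℝ)) : ℂ)) - G μ ν‖ ^ 2 =
      ∑ i : Fin d × Fin d, ‖((projK e ⊗ₖ projK e) *ᵥ fun i : Fin d × Fin d => G i.1 i.2) i‖ ^ 2 := by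
  rw [Fintype.sum_prod_type]
  refine Finset.sum_congr rfl fun μ _ => Finset.sum_congr rfl fun ν _ => ?_
  have h := hodge_point e hG μ ν
  have hK : ((projK e ⊗ₖ projK e) *ᵥ fun i : Fin d × Fin d => G i.1 i.2) (μ, ν) =
      ∑ l, ∑ κ, projK e μ l * projK e ν κ * G l κ := by
    rw [Matrix.mulVec, dotProduct, Fintype.sum_prod_type]
    simp only [Matrix.kroneckerMap_apply]
  rw [hK, ← norm_neg]
  congr 1
  rw [h]
  ring

end Hodge

/-! ## §3 The unconstrained fibre minimum IS the regularized (7.1.14) form, at every momentum -/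

section Energy

variable {n : ℕ}

/-- kernel: `Re⟨f, τ₁^C(p′)f⟩ = ½Σ_l Re⟨f, (l-term)f⟩` and each l-term form is `‖(P⊗P)(w·f)‖²`. [cite: BalabanImbrieJaffe1985, (7.1.14) p.322] -/
theorem tau1C_form_re_eq (n M : ℕ) (p : Fin d → ℝ) (f : Fin d → Fin d → ℂ) :
    (tensorInner f (tau1C n M p) f).re = 1 / 2 * ∑ m ∈ lShifts d M,
      ∑ i : Fin d × Fin d, ‖((projK (dSym ((n : ℝ)⁻¹) (shiftMom p m)) ⊗ₖ projK (dSym ((n : ℝ)⁻¹) (shiftMom p m))) *ᵥ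
        fun i : Fin d × Fin d => gW n (shiftMom p m) f i.1 i.2) i‖ ^ 2 := by
  have h12 : (1 / 2 : ℂ) = ((1 / 2 : ℝ) : ℂ) := by norm_num
  rw [tensorInner_tau1C, h12, Complex.re_ofReal_mul, Complex.re_sum]
  congr 1
  refine Finset.sum_congr rfl fun m _ => ?_
  rw [tensorInner_t1C_eq, Complex.ofReal_re]

/-- `⟨f, τ₁^C(p′)f⟩` is real at every momentum. [cite: BalabanImbrieJaffe1985, (7.1.14) p.322] -/
theorem tau1C_form_im (n M : ℕ) (p : Fin d → ℝ) (f : Fin d → Fin d → ℂ) : (tensorInner f (tau1C n M p) f).im = 0 :=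
  (half_term_le_tau1C n M p f (zero_mem_lShifts d M)).2

/-- **`Re⟨f, τ₁^C(p′)f⟩ ≤ ‖∂A − Q^{e*}_kf‖²` FOR EVERY η-BOND FIELD `A`, AT EVERY MOMENTUM `p′`** (closed-cube weights, two-forms `f`,
`0 < n`, any cut-off `M`): shift by shift, `|∂∧A(l) − c̄·(w·f)|² ≥ ‖(P⊗P)(c̄·w·f)‖² = ‖(P⊗P)(w·f)‖²`. [cite: BalabanImbrieJaffe1985, (7.1.17) p.323] -/
theorem tau1C_form_le_energyC (hn : 0 < n) (M : ℕ) (p : Fin d → ℝ) {f : Fin d → Fin d → ℂ} (hf : IsTwoForm f)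
    (A : (Fin d → ℤ) → Fin d → ℂ) : (tensorInner f (tau1C n M p) f).re ≤ energyC n M p A f := by
  rw [tau1C_form_re_eq]
  unfold energyC pNormSq
  refine mul_le_mul_of_nonneg_left (Finset.sum_le_sum fun m _ => ?_) (by norm_num)
  set q := shiftMom p m with hq
  set e := dSym ((n : ℝ)⁻¹) q with he
  set c : ℂ := ∏ ρ, conj (zC n q ρ) ^ (n - 1) with hc
  have hG : IsTwoForm (fun μ ν => c * gW n q f μ ν) := fun μ ν => by
    show c * gW n q f ν μ = -(c * gW n q f μ ν)
    rw [gW_twoForm n q hf μ ν, mul_neg]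
  have hvec : (fun i : Fin d × Fin d => c * gW n q f i.1 i.2) = c • fun i : Fin d × Fin d => gW n q f i.1 i.2 := by
    funext i; rfl
  have hpt : ∀ μ ν, curlF ((n : ℝ)⁻¹) p A m μ ν - qeStarC n p f m μ ν = e μ * A m ν - e ν * A m μ - c * gW n q f μ ν := by
    intro μ ν
    rw [qeStarC_eq_phase_mul_gW hn p m hf μ ν]
    rfl
  calc ∑ i : Fin d × Fin d, ‖((projK e ⊗ₖ projK e) *ᵥ fun i : Fin d × Fin d => gW n q f i.1 i.2) i‖ ^ 2
      = ∑ i : Fin d × Fin d, ‖((projK e ⊗ₖ projK e) *ᵥ fun i : Fin d × Fin d => c * gW n q f i.1 i.2) i‖ ^ 2 := by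
        rw [hvec, Matrix.mulVec_smul]
        refine Finset.sum_congr rfl fun i _ => ?_
        rw [Pi.smul_apply, smul_eq_mul, norm_mul, hc, norm_phase, one_mul]
    _ ≤ ∑ μ, ∑ ν, ‖e μ * A m ν - e ν * A m μ - c * gW n q f μ ν‖ ^ 2 := curl_energy_ge e (A m) (fun μ ν => c * gW n q f μ ν)
    _ = ∑ μ, ∑ ν, ‖curlF ((n : ℝ)⁻¹) p A m μ ν - qeStarC n p f m μ ν‖ ^ 2 := by
        simp only [hpt]

/-- **The minimum is attained at `B₀ = Δ⁻¹∂^*Q^{e*}_kf`** (shift by shift; at a shift with `∂(p′+l) = 0` — only `p′ = 0, l = 0` on the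
closed cube — `B₀(l) = 0` and the bracket is the identity): `‖∂B₀ − Q^{e*}_kf‖² = Re⟨f, τ₁^C(p′)f⟩`. [cite: BalabanImbrieJaffe1985, (7.1.17) p.323] -/
theorem energyC_hodge_eq (hn : 0 < n) (M : ℕ) (p : Fin d → ℝ) {f : Fin d → Fin d → ℂ} (hf : IsTwoForm f) :
    energyC n M p (fun m ν => (((lapSym ((n : ℝ)⁻¹) (shiftMom p m))⁻¹ : ℝ) : ℂ) * coD ((n : ℝ)⁻¹) p (qeStarC n p f) m ν) f
      = (tensorInner f (tau1C n M p) f).re := by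
  rw [tau1C_form_re_eq]
  unfold energyC pNormSq
  congr 1
  refine Finset.sum_congr rfl fun m _ => ?_
  set q := shiftMom p m with hq
  set e := dSym ((n : ℝ)⁻¹) q with he
  set c : ℂ := ∏ ρ, conj (zC n q ρ) ^ (n - 1) with hc
  have hG : IsTwoForm (fun μ ν => c * gW n q f μ ν) := fun μ ν => by
    show c * gW n q f ν μ = -(c * gW n q f μ ν)
    rw [gW_twoForm n q hf μ ν, mul_neg]
  have hvec : (fun i : Fin d × Fin d => c * gW n q f i.1 i.2) = c • fun i : Fin d × Fin d => gW n q f i.1 i.2 := by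
    funext i; rfl
  have hN : (((∑ ρ, ‖e ρ‖ ^ 2 : ℝ)) : ℂ) = ((lapSym ((n : ℝ)⁻¹) q : ℝ) : ℂ) := by rw [he, lapSym]
  have hb : ∀ ν, (((lapSym ((n : ℝ)⁻¹) q)⁻¹ : ℝ) : ℂ) * coD ((n : ℝ)⁻¹) p (qeStarC n p f) m ν =
      (∑ l, conj (e l) * (c * gW n q f l ν)) / (((∑ ρ, ‖e ρ‖ ^ 2 : ℝ)) : ℂ) := by
    intro ν
    rw [hN, Complex.ofReal_inv, coD, div_eq_inv_mul]
    congr 1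
    exact Finset.sum_congr rfl fun l _ => by rw [qeStarC_eq_phase_mul_gW hn p m hf l ν]
  have hpt : ∀ μ ν, curlF ((n : ℝ)⁻¹) p
        (fun m ν => (((lapSym ((n : ℝ)⁻¹) (shiftMom p m))⁻¹ : ℝ) : ℂ) * coD ((n : ℝ)⁻¹) p (qeStarC n p f) m ν) m μ ν -
        qeStarC n p f m μ ν =
      e μ * ((∑ l, conj (e l) * (c * gW n q f l ν)) / (((∑ ρ, ‖e ρ‖ ^ 2 : ℝ)) : ℂ)) -
        e ν * ((∑ l, conj (e l) * (c * gW n q f l μ)) / (((∑ ρ, ‖e ρ‖ ^ 2 : ℝ)) : ℂ)) - c * gW n q f μ ν := by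
    intro μ ν
    rw [qeStarC_eq_phase_mul_gW hn p m hf μ ν, curlF, ← hq, ← he, hb μ, hb ν]
  calc ∑ μ, ∑ ν, ‖curlF ((n : ℝ)⁻¹) p
          (fun m ν => (((lapSym ((n : ℝ)⁻¹) (shiftMom p m))⁻¹ : ℝ) : ℂ) * coD ((n : ℝ)⁻¹) p (qeStarC n p f) m ν) m μ ν -
          qeStarC n p f m μ ν‖ ^ 2
      = ∑ μ, ∑ ν, ‖e μ * ((∑ l, conj (e l) * (c * gW n q f l ν)) / (((∑ ρ, ‖e ρ‖ ^ 2 : ℝ)) : ℂ)) -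
          e ν * ((∑ l, conj (e l) * (c * gW n q f l μ)) / (((∑ ρ, ‖e ρ‖ ^ 2 : ℝ)) : ℂ)) - c * gW n q f μ ν‖ ^ 2 := by
        simp only [hpt]
    _ = ∑ i : Fin d × Fin d, ‖((projK e ⊗ₖ projK e) *ᵥ fun i : Fin d × Fin d => c * gW n q f i.1 i.2) i‖ ^ 2 :=
        curl_energy_hodge e hG
    _ = ∑ i : Fin d × Fin d, ‖((projK e ⊗ₖ projK e) *ᵥ fun i : Fin d × Fin d => gW n q f i.1 i.2) i‖ ^ 2 := by
        rw [hvec, Matrix.mulVec_smul]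
        refine Finset.sum_congr rfl fun i _ => ?_
        rw [Pi.smul_apply, smul_eq_mul, norm_mul, hc, norm_phase, one_mul]

/-- **`m°_{p′}(f) = min_A ‖∂A − Q^{e*}_kf‖²_C = Re⟨f, τ₁^C(p′)f⟩` AT EVERY MOMENTUM `p′ ∈ ℝ^d`** (two-forms `f`, `0 < n`, any `M`): the
unconstrained fibre problem behind (7.1.17) `τ₁ = Q^e_k(I − P_∂)Q^{e*}_k` has the regularized (7.1.14) as its value — axis fibres and
`p′ = 0` included, no genericity hypothesis. [cite: BalabanImbrieJaffe1985, (7.1.17) p.323] -/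
theorem isLeast_energyC_free (hn : 0 < n) (M : ℕ) (p : Fin d → ℝ) {f : Fin d → Fin d → ℂ} (hf : IsTwoForm f) :
    IsLeast (Set.range fun A : (Fin d → ℤ) → Fin d → ℂ => energyC n M p A f) (tensorInner f (tau1C n M p) f).re :=
  ⟨⟨_, energyC_hodge_eq hn M p hf⟩, by rintro _ ⟨A, rfl⟩; exact tau1C_form_le_energyC hn M p hf A⟩

/-- … as an infimum: `⨅_A ‖∂A − Q^{e*}_kf‖²_C = Re⟨f, τ₁^C(p′)f⟩`. [cite: BalabanImbrieJaffe1985, (7.1.17) p.323] -/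
theorem iInf_energyC_eq_tau1C_form (hn : 0 < n) (M : ℕ) (p : Fin d → ℝ) {f : Fin d → Fin d → ℂ} (hf : IsTwoForm f) :
    ⨅ A : (Fin d → ℤ) → Fin d → ℂ, energyC n M p A f = (tensorInner f (tau1C n M p) f).re := by
  rw [← sInf_range]
  exact (isLeast_energyC_free hn M p hf).csInf_eq

end Energy

/-! ## §4 The `Tor` level: `fibreMinU (2M+1) N q φ = 2·Re⟨φ, τ₁^C(q)φ⟩` at EVERY dual momentum -/

section TorLevel

variable (M : ℕ) {N : Fin d → ℕ}

/-- **`m°_{p′}(φ) = 2·Re⟨φ, τ₁^C(p′)φ⟩` AT EVERY DUAL MOMENTUM** (odd block size `n = 2M + 1`, two-forms `φ`; the `2` = ordered-pair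
convention of the `Tor` two-forms vs the plaquette pairing (2.20)): gen 6's `fibreMinU_eq_two_mul_tau1Form` without the hypothesis
*"all `p′_μ ≠ 0`"*, the printed (7.1.14) being replaced by p10's closed-cube `tau1C` (equal to it off the axes, `tau1C_form_eq`).
[cite: BalabanImbrieJaffe1985, (7.1.14) p.322] -/
theorem fibreMinU_eq_two_mul_tau1C_form (q : Tor N) {φ : Fin d × Fin d → ℂ} (hφ : ∀ μ ν, φ (ν, μ) = -φ (μ, ν)) :
    fibreMinU (2 * M + 1) N q φ
      = 2 * (tensorInner (fun μ ν => φ (μ, ν)) (tau1C (2 * M + 1) M (sOf N q)) (fun μ ν => φ (μ, ν))).re := by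
  have hn : 0 < 2 * M + 1 := by omega
  have hf : IsTwoForm (fun μ ν => φ (μ, ν)) := fun μ ν => hφ μ ν
  set A₀ : (Fin d → ℤ) → Fin d → ℂ := fun m ν =>
    (((lapSym (((2 * M + 1 : ℕ) : ℝ)⁻¹) (shiftMom (sOf N q) m))⁻¹ : ℝ) : ℂ) *
      coD (((2 * M + 1 : ℕ) : ℝ)⁻¹) (sOf N q) (qeStarC (2 * M + 1) (sOf N q) (fun μ ν => φ (μ, ν))) m ν with hA₀
  apply le_antisymm
  · set α : (Fin d → Fin (2 * M + 1)) → Fin d → ℂ := fun k => A₀ (resR M k) with hα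
    have hcomp : (fun m => α (resE M m)) = fun m => A₀ (resR M (resE M m)) := rfl
    calc fibreMinU (2 * M + 1) N q φ ≤ fibreEnergy (2 * M + 1) N q α φ := fibreMinU_le _ _ q α φ
      _ = 2 * energyC (2 * M + 1) M (sOf N q) (fun m => α (resE M m)) (fun μ ν => φ (μ, ν)) := fibreEnergy_eq M q α hφ
      _ = _ := by rw [hcomp, energyC_comp_res, hA₀, energyC_hodge_eq hn M (sOf N q) hf]
  · refine (le_fibreMinU_iff _ _).2 fun α => ?_
    rw [fibreEnergy_eq M q α hφ]
    have h := tau1C_form_le_energyC hn M (sOf N q) hf (fun m => α (resE M m))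
    linarith

/-- Hence `0 ≤ Re⟨φ, τ₁^C(q)φ⟩ ≤ ½·m_{q}(φ)`-type facts need no genericity: `τ₁^C(q) ≥ 0` on two-forms at every `q`.
[cite: BalabanImbrieJaffe1985, (7.1.14) p.322] -/
theorem tau1C_form_nonneg (n M' : ℕ) (p : Fin d → ℝ) (f : Fin d → Fin d → ℂ) : 0 ≤ (tensorInner f (tau1C n M' p) f).re := by
  have h0 := (BIJ85SigmaClosedCubeZero.tensorInner_t1C_nonneg n (shiftMom p 0) f).1
  have h1 := (half_term_le_tau1C n M' p f (zero_mem_lShifts d M')).1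
  linarith

end TorLevel

/-! ## §5 The τ₁ of record: `⟨ψ, τ₁(p′)ψ⟩ = Re⟨ψ^asym, τ₁^C(p′)ψ^asym⟩` at EVERY dual momentum -/

section Record

variable {P : Params} {k : ℕ}

/-- **`τ₁(p′)` OF THE τ₁ OF RECORD IS THE REGULARIZED (7.1.14) AT EVERY DUAL MOMENTUM, AXES INCLUDED**: for p33's
`τ₁ = Q^e_k(I − P_∂)Q^{e*}_k` on the torus (weight `η^d`, `η = L^{−k}`, any curl factor `c ≠ 0`; `k ≤ m + K`, `2 ≤ d`, `L^k = 2M + 1`) and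
every fibre vector `ψ`: `⟨ψ, τ₁(p′)ψ⟩ = Re⟨ψ^asym, tau1C (2M+1) M (p′) ψ^asym⟩` for EVERY `p′ : Tor (torN P k)` — p10's closed-cube (7.1.14)
(`v_μ` continued by 1, bracket `= δ` at `∂ = 0`) on the right; no hypothesis on the components of `p′`.
[cite: BalabanImbrieJaffe1985, (7.1.14) p.322] -/
theorem symb_tau1Matrix_form_eq_tau1C (hd : 2 ≤ P.d) (hk : k ≤ P.m + P.K) {c : ℝ} (hc : c ≠ 0) {M : ℕ}
    (hM : P.L ^ k = 2 * M + 1) (p : Tor (torN P k)) (ψ : Orient P → ℂ) :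
    star ψ ⬝ᵥ (symb (torN P k) (Orient P) (tau1Matrix hd (P.eta k ^ P.d) c k) p *ᵥ ψ)
      = (((tensorInner (fun μ ν => asymO ψ (μ, ν)) (tau1C (2 * M + 1) M (sOf (Mk P k) p))
          (fun μ ν => asymO ψ (μ, ν))).re : ℝ) : ℂ) := by
  haveI : NeZero (2 * M + 1) := ⟨by omega⟩
  rw [symb_tau1Matrix_form_eq_half_fibreMinU hd hk hc p ψ, fibreMinU_congr_n hM,
    fibreMinU_eq_two_mul_tau1C_form M p (asymO_swap ψ)]
  push_cast
  ring

end Record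

end

end Literature.MathematicalPhysics.QuantumFieldTheory.BalabanImbrieJaffe1984to88.BIJ85Tau1ClosedCube
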